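import Literature.NumberTheory.EllipticCurves.CasselsTatePairingSelmerTwo
import HarnessLib

/-!
# The ADJUGATE of an alternating form on three generators (crux stmt-BirchSwinnertonDyer-20509 `RamifiedOffTYZOfFacts`,
# line `offtyz-v7`, LEAD cruxlead-20509 g22, cycle 23) — the linear algebra behind the «adjugate pin» of the idea
# `cassels-tate-entries` (item 23431), piece (E)×(S)

HONEST FRAMING (cell `bsd-print-cf2`, route `PrintCf2`; `--supports stmt-BirchSwinnertonDyer-20509`; `def`-free, fact-free, no
`sorry`). Pure algebra: nothing about elliptic curves is proved here; BSD is not proved by any of this; 20509 / 23431 stay OPEN.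

WHAT. The idea card (`Cruxes/RamifiedJumpOneLevelTwoOfFacts/Ideas/cassels-tate-entries.md`, Addendum «ADJUGATE FORM OF THE PIN»)
reads the Cassels–Tate form `C` on `V = Sel₂(E_n)/κ(E_n[2]) ≅ 𝔽₂³` through its three ENTRIES `c₁₂, c₁₃, c₂₃` on a symbol basis and
states: `C = 0 ⟺ (c₁₂, c₁₃, c₂₃) = 0`, and otherwise the radical LINE of `C` is spanned by the adjugate (Pfaffian) vector
`v = (c₂₃, c₁₃, c₁₂)` — «`adj(C) = v vᵀ`». This file proves exactly that, for a bi-additive ALTERNATING form `C : S →+ S →+ T` on an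
abelian group `S` killed by `2` (so every value `C s t` is killed by `2`), with values in a group `T` whose `2`-torsion is COLLINEAR
(`2x = 2y = 0`, `x, y ≠ 0 ⟹ x = y`: e.g. `ℚ/ℤ = AddCircle 1`, the tree's currency for the Cassels–Tate pairing, §0), and three elements
`s₁ s₂ s₃` generating `S` together with the radical:

* §1 `adjugate_apply_eq_zero` — the adjugate vector `v = [c₂₃ ≠ 0]s₁ + [c₁₃ ≠ 0]s₂ + [c₁₂ ≠ 0]s₃` lies in the radical (`⟨v, ·⟩ ≡ 0`);
  `forall_forall_apply_eq_zero_iff_entries` — `C ≡ 0 ⟺ c₁₂ = c₁₃ = c₂₃ = 0`.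
* §2 `combination_eq_zero_or_eq_adjugate` — conversely, a combination `b₁s₁ + b₂s₂ + b₃s₃` (`bᵢ ∈ ℤ`) in the radical of a NON-ZERO `C`
  is `0` or `v` (the kernel of a non-zero alternating `3 × 3` matrix over `𝔽₂` is the line through its adjugate vector; `decide` on `𝔽₂⁶`).
* §3 `natCard_le_of_generated_two` — counting: if `S` is generated by the image of a finite group `A` and TWO elements, `#S ≤ 4·#A`
  (used by the companion file to show that `v` is NOT a torsion class on the jump-one class, where `#Sel₂ = 32 > 4·#E_n(ℚ)[2] = 16`).

The companion file `PrintCf2RamifiedOffTYZCasselsTateAdjugatePin.lean` applies this to `S = Sel₂(E_n)`, `C` = the Cassels–Tate form,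
generators = any three Selmer classes spanning `Sel₂(E_n)` over the torsion classes `κ₂(E_n(ℚ)[2])`.
References: the identity `adj(X) = pf-vector ⊗ pf-vector` for a skew `3 × 3` matrix is classical linear algebra [folklore]; its use here
is the card's Addendum (cruxidea-23431-1, 2026-08-30).
-/

noncomputable section

open scoped Classical

set_option autoImplicit false

namespace Summit.BirchSwinnertonDyer.PrintCf2.AdjugateForm

/-! ## §0 Collinear `2`-torsion: the value group `ℚ/ℤ` -/

section Values

/-- In `ℚ/ℤ = AddCircle (1 : ℚ)` an element killed by `2` is `0` or `½`. [folklore] -/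
theorem addCircle_eq_zero_or_eq_half_of_two_nsmul (x : AddCircle (1 : ℚ)) (hx : (2 : ℕ) • x = 0) :
    x = 0 ∨ x = (((1 / 2 : ℚ)) : AddCircle (1 : ℚ)) := by
  induction x using QuotientAddGroup.induction_on with
  | H q =>
    have h2 : (((2 : ℕ) • q : ℚ) : AddCircle (1 : ℚ)) = 0 := by
      rw [AddCircle.coe_nsmul]; exact hx
    rw [AddCircle.coe_eq_zero_iff] at h2
    obtain ⟨m, hm⟩ := h2
    rw [nsmul_eq_mul, zsmul_eq_mul, mul_one, Nat.cast_ofNat] at hm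
    -- `q = m / 2`
    rcases Int.even_or_odd m with ⟨k, hk⟩ | ⟨k, hk⟩
    · left
      rw [AddCircle.coe_eq_zero_iff]
      refine ⟨k, ?_⟩
      rw [zsmul_eq_mul, mul_one]
      have : (m : ℚ) = 2 * k := by rw [hk]; push_cast; ring
      linarith
    · right
      rw [eq_comm, ← sub_eq_zero, ← AddCircle.coe_sub, AddCircle.coe_eq_zero_iff]
      refine ⟨-k, ?_⟩
      rw [zsmul_eq_mul, mul_one]
      have : (m : ℚ) = 2 * k + 1 := by rw [hk]; push_cast; ring
      push_cast
      linarith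

/-- **Collinear `2`-torsion in `ℚ/ℤ`**: two non-zero elements of `AddCircle (1 : ℚ)` killed by `2` are equal (both are `½`). This is
the hypothesis `hT` of the adjugate lemmas below, discharged for the tree's value group of the Cassels–Tate pairing. [folklore] -/
theorem addCircle_two_torsion_collinear (x y : AddCircle (1 : ℚ)) (hx : (2 : ℕ) • x = 0) (hy : (2 : ℕ) • y = 0) :
    x = 0 ∨ y = 0 ∨ x = y := by
  rcases addCircle_eq_zero_or_eq_half_of_two_nsmul x hx with rfl | hx'
  · exact Or.inl rfl
  rcases addCircle_eq_zero_or_eq_half_of_two_nsmul y hy with rfl | hy'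
  · exact Or.inr (Or.inl rfl)
  exact Or.inr (Or.inr (hx'.trans hy'.symm))

end Values

/-! ## §1 The adjugate vector lies in the radical; `C ≡ 0 ⟺` the three entries vanish -/

section Form

variable {S : Type*} [AddCommGroup S] {T : Type*} [AddCommGroup T] (C : S →+ S →+ T)

/-- An alternating bi-additive form is skew: `⟨s, t⟩ = −⟨t, s⟩` (polarisation of `⟨s + t, s + t⟩ = 0`). [folklore] -/
theorem apply_eq_neg_apply (halt : ∀ s, C s s = 0) (s t : S) : C s t = -C t s := by
  have h := halt (s + t)
  simp only [map_add, AddMonoidHom.add_apply, halt s, halt t, zero_add, add_zero] at h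
  exact eq_neg_of_add_eq_zero_left ((add_comm _ _).trans h)

/-- On a group killed by `2`, every value of a bi-additive form is killed by `2`. [folklore] -/
theorem two_nsmul_apply_eq_zero (h2 : ∀ s : S, (2 : ℕ) • s = 0) (s t : S) : (2 : ℕ) • C s t = 0 := by
  rw [← map_nsmul, h2 t, map_zero]

/-- For an alternating form on a group killed by `2`: `⟨s, t⟩ = ⟨t, s⟩` (skew + values killed by `2`). [folklore] -/
theorem apply_comm (h2 : ∀ s : S, (2 : ℕ) • s = 0) (halt : ∀ s, C s s = 0) (s t : S) : C s t = C t s := by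
  rw [apply_eq_neg_apply C halt s t, eq_comm, ← sub_eq_zero, sub_neg_eq_add, ← two_nsmul]
  exact two_nsmul_apply_eq_zero C h2 t s

/-- A radical element pairs to zero on the RIGHT as well (skewness). [folklore] -/
theorem apply_eq_zero_of_radical (halt : ∀ s, C s s = 0) {r : S} (hr : ∀ u, C r u = 0) (s : S) : C s r = 0 := by
  rw [apply_eq_neg_apply C halt s r, hr s, neg_zero]

/-- The form applied to a conditional vector: `⟨if p then 0 else s, t⟩ = if p then 0 else ⟨s, t⟩`. [folklore] -/
theorem apply_ite_zero (p : Prop) [Decidable p] (s t : S) :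
    C (if p then 0 else s) t = if p then 0 else C s t := by
  split_ifs with h
  · rw [map_zero, AddMonoidHom.zero_apply]
  · rfl

/-- The cancellation behind the adjugate identity: for `x, y` killed by `2` in a group with collinear `2`-torsion,
`[x ≠ 0]·y + [y ≠ 0]·x = 0`. [folklore] -/
theorem ite_add_ite_eq_zero (hT : ∀ x y : T, (2 : ℕ) • x = 0 → (2 : ℕ) • y = 0 → x = 0 ∨ y = 0 ∨ x = y)
    {x y : T} (hx : (2 : ℕ) • x = 0) (hy : (2 : ℕ) • y = 0) :
    (if x = 0 then (0 : T) else y) + (if y = 0 then 0 else x) = 0 := by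
  rcases hT x y hx hy with rfl | rfl | rfl
  · simp only [if_true, zero_add, ite_self]
  · simp only [if_true, add_zero, ite_self]
  · by_cases h : x = 0
    · rw [if_pos h, add_zero]
    · rw [if_neg h, ← two_nsmul, hx]

variable (s₁ s₂ s₃ : S)

/-- **The adjugate vector pairs to zero with `s₁`**: `⟨v, s₁⟩ = [c₁₃ ≠ 0]c₂₁ + [c₁₂ ≠ 0]c₃₁ = [c₁₃ ≠ 0]c₁₂ + [c₁₂ ≠ 0]c₁₃ = 0`.
[folklore] -/
theorem adjugate_apply_gen₁ (h2 : ∀ s : S, (2 : ℕ) • s = 0) (halt : ∀ s, C s s = 0)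
    (hT : ∀ x y : T, (2 : ℕ) • x = 0 → (2 : ℕ) • y = 0 → x = 0 ∨ y = 0 ∨ x = y) (v : S)
    (hv : v = (if C s₂ s₃ = 0 then 0 else s₁) + (if C s₁ s₃ = 0 then 0 else s₂) + (if C s₁ s₂ = 0 then 0 else s₃)) :
    C v s₁ = 0 := by
  subst hv
  rw [map_add, map_add, AddMonoidHom.add_apply, AddMonoidHom.add_apply, apply_ite_zero, apply_ite_zero,
    apply_ite_zero, halt s₁, ite_self, zero_add, apply_comm C h2 halt s₂ s₁, apply_comm C h2 halt s₃ s₁]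
  exact ite_add_ite_eq_zero hT (two_nsmul_apply_eq_zero C h2 s₁ s₃) (two_nsmul_apply_eq_zero C h2 s₁ s₂)

/-- **The adjugate vector pairs to zero with `s₂`**: `⟨v, s₂⟩ = [c₂₃ ≠ 0]c₁₂ + [c₁₂ ≠ 0]c₃₂ = 0`. [folklore] -/
theorem adjugate_apply_gen₂ (h2 : ∀ s : S, (2 : ℕ) • s = 0) (halt : ∀ s, C s s = 0)
    (hT : ∀ x y : T, (2 : ℕ) • x = 0 → (2 : ℕ) • y = 0 → x = 0 ∨ y = 0 ∨ x = y) (v : S)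
    (hv : v = (if C s₂ s₃ = 0 then 0 else s₁) + (if C s₁ s₃ = 0 then 0 else s₂) + (if C s₁ s₂ = 0 then 0 else s₃)) :
    C v s₂ = 0 := by
  subst hv
  rw [map_add, map_add, AddMonoidHom.add_apply, AddMonoidHom.add_apply, apply_ite_zero, apply_ite_zero,
    apply_ite_zero, halt s₂, ite_self, add_zero, apply_comm C h2 halt s₃ s₂]
  exact ite_add_ite_eq_zero hT (two_nsmul_apply_eq_zero C h2 s₂ s₃) (two_nsmul_apply_eq_zero C h2 s₁ s₂)

/-- **The adjugate vector pairs to zero with `s₃`**: `⟨v, s₃⟩ = [c₂₃ ≠ 0]c₁₃ + [c₁₃ ≠ 0]c₂₃ = 0`. [folklore] -/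
theorem adjugate_apply_gen₃ (h2 : ∀ s : S, (2 : ℕ) • s = 0) (halt : ∀ s, C s s = 0)
    (hT : ∀ x y : T, (2 : ℕ) • x = 0 → (2 : ℕ) • y = 0 → x = 0 ∨ y = 0 ∨ x = y) (v : S)
    (hv : v = (if C s₂ s₃ = 0 then 0 else s₁) + (if C s₁ s₃ = 0 then 0 else s₂) + (if C s₁ s₂ = 0 then 0 else s₃)) :
    C v s₃ = 0 := by
  subst hv
  rw [map_add, map_add, AddMonoidHom.add_apply, AddMonoidHom.add_apply, apply_ite_zero, apply_ite_zero,
    apply_ite_zero, halt s₃, ite_self, add_zero]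
  exact ite_add_ite_eq_zero hT (two_nsmul_apply_eq_zero C h2 s₂ s₃) (two_nsmul_apply_eq_zero C h2 s₁ s₃)

/-- A vector pairing to zero with the three generators pairs to zero with everything (generation over the radical).
[folklore] -/
theorem apply_eq_zero_of_apply_gen_eq_zero (halt : ∀ s, C s s = 0) (x : S) (hx₁ : C x s₁ = 0) (hx₂ : C x s₂ = 0)
    (hx₃ : C x s₃ = 0)
    (hgen : ∀ t : S, ∃ r : S, (∀ u, C r u = 0) ∧ ∃ b₁ b₂ b₃ : ℤ, t = r + b₁ • s₁ + b₂ • s₂ + b₃ • s₃) (u : S) :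
    C x u = 0 := by
  obtain ⟨r, hr, b₁, b₂, b₃, rfl⟩ := hgen u
  rw [map_add, map_add, map_add, map_zsmul, map_zsmul, map_zsmul, apply_eq_zero_of_radical C halt hr, hx₁, hx₂, hx₃,
    smul_zero, smul_zero, smul_zero, add_zero, add_zero, add_zero]

/-- **THE ADJUGATE VECTOR IS IN THE RADICAL.** For an alternating bi-additive form `C` on a group `S` killed by `2`, with values in a
group with collinear `2`-torsion, and `s₁ s₂ s₃` generating `S` together with radical elements: the adjugate vector
`v = [c₂₃ ≠ 0]s₁ + [c₁₃ ≠ 0]s₂ + [c₁₂ ≠ 0]s₃` (`c_ij = ⟨sᵢ, sⱼ⟩`) satisfies `⟨v, t⟩ = 0` for every `t`. [folklore] -/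
theorem adjugate_apply_eq_zero (h2 : ∀ s : S, (2 : ℕ) • s = 0) (halt : ∀ s, C s s = 0)
    (hT : ∀ x y : T, (2 : ℕ) • x = 0 → (2 : ℕ) • y = 0 → x = 0 ∨ y = 0 ∨ x = y) (v : S)
    (hv : v = (if C s₂ s₃ = 0 then 0 else s₁) + (if C s₁ s₃ = 0 then 0 else s₂) + (if C s₁ s₂ = 0 then 0 else s₃))
    (hgen : ∀ t : S, ∃ r : S, (∀ u, C r u = 0) ∧ ∃ b₁ b₂ b₃ : ℤ, t = r + b₁ • s₁ + b₂ • s₂ + b₃ • s₃) (t : S) :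
    C v t = 0 :=
  apply_eq_zero_of_apply_gen_eq_zero C s₁ s₂ s₃ halt v (adjugate_apply_gen₁ C s₁ s₂ s₃ h2 halt hT v hv)
    (adjugate_apply_gen₂ C s₁ s₂ s₃ h2 halt hT v hv) (adjugate_apply_gen₃ C s₁ s₂ s₃ h2 halt hT v hv) hgen t

/-- **`C ≡ 0 ⟺ c₁₂ = c₁₃ = c₂₃ = 0`**: an alternating form on a group killed by `2`, generated by `s₁ s₂ s₃` over its radical, vanishes
identically iff its three entries vanish. [folklore] -/
theorem forall_forall_apply_eq_zero_iff_entries (h2 : ∀ s : S, (2 : ℕ) • s = 0) (halt : ∀ s, C s s = 0)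
    (hgen : ∀ t : S, ∃ r : S, (∀ u, C r u = 0) ∧ ∃ b₁ b₂ b₃ : ℤ, t = r + b₁ • s₁ + b₂ • s₂ + b₃ • s₃) :
    (∀ s t, C s t = 0) ↔ (C s₁ s₂ = 0 ∧ C s₁ s₃ = 0 ∧ C s₂ s₃ = 0) := by
  refine ⟨fun h => ⟨h _ _, h _ _, h _ _⟩, fun ⟨h₁₂, h₁₃, h₂₃⟩ s t => ?_⟩
  have h₂₁ : C s₂ s₁ = 0 := by rw [apply_comm C h2 halt, h₁₂]
  have h₃₁ : C s₃ s₁ = 0 := by rw [apply_comm C h2 halt, h₁₃]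
  have h₃₂ : C s₃ s₂ = 0 := by rw [apply_comm C h2 halt, h₂₃]
  -- the three generators pair to zero with everything, hence so does every combination
  have hg₁ := apply_eq_zero_of_apply_gen_eq_zero C s₁ s₂ s₃ halt s₁ (halt s₁) h₁₂ h₁₃ hgen
  have hg₂ := apply_eq_zero_of_apply_gen_eq_zero C s₁ s₂ s₃ halt s₂ h₂₁ (halt s₂) h₂₃ hgen
  have hg₃ := apply_eq_zero_of_apply_gen_eq_zero C s₁ s₂ s₃ halt s₃ h₃₁ h₃₂ (halt s₃) hgen
  obtain ⟨r, hr, b₁, b₂, b₃, rfl⟩ := hgen s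
  rw [map_add, map_add, map_add, map_zsmul, map_zsmul, map_zsmul, AddMonoidHom.add_apply, AddMonoidHom.add_apply,
    AddMonoidHom.add_apply, AddMonoidHom.zsmul_apply, AddMonoidHom.zsmul_apply, AddMonoidHom.zsmul_apply, hr t, hg₁ t,
    hg₂ t, hg₃ t, smul_zero, smul_zero, smul_zero, add_zero, add_zero, add_zero]

end Form


/-! ## §2 Conversely: a combination in the radical of a non-zero form is `0` or the adjugate vector -/

section Kernel

variable {S : Type*} [AddCommGroup S] {T : Type*} [AddCommGroup T] (C : S →+ S →+ T) (s₁ s₂ s₃ : S)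

/-- An integer multiple of an element killed by `2` is `0` or that element. [folklore] -/
theorem zsmul_eq_ite_of_two_nsmul {M : Type*} [AddCommGroup M] (b : ℤ) {x : M} (hx : (2 : ℕ) • x = 0) :
    b • x = if 2 ∣ b then 0 else x := by
  rcases Int.even_or_odd b with ⟨k, rfl⟩ | ⟨k, rfl⟩
  · rw [if_pos ⟨k, by ring⟩, ← two_mul, mul_comm, mul_zsmul, two_zsmul, ← two_nsmul, hx, smul_zero]
  · rw [if_neg (by omega), add_zsmul, one_zsmul, mul_comm, mul_zsmul, two_zsmul, ← two_nsmul, hx, smul_zero,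
      zero_add]

/-- Two conditional copies of a non-zero `τ` with `2τ = 0` sum to zero iff the conditions agree. [folklore] -/
theorem ite_add_ite_eq_zero_iff {τ : T} (hτ : τ ≠ 0) (h2τ : (2 : ℕ) • τ = 0) (p q : Prop) [Decidable p] [Decidable q] :
    (if p then 0 else τ) + (if q then 0 else τ) = 0 ↔ (p ↔ q) := by
  by_cases hp : p <;> by_cases hq : q
  · rw [if_pos hp, if_pos hq, add_zero]
    exact ⟨fun _ => ⟨fun _ => hq, fun _ => hp⟩, fun _ => rfl⟩
  · rw [if_pos hp, if_neg hq, zero_add]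
    exact ⟨fun h => absurd h hτ, fun h => absurd (h.mp hp) hq⟩
  · rw [if_neg hp, if_pos hq, add_zero]
    exact ⟨fun h => absurd h hτ, fun h => absurd (h.mpr hq) hp⟩
  · rw [if_neg hp, if_neg hq, ← two_nsmul, h2τ]
    exact ⟨fun _ => ⟨fun h => absurd h hp, fun h => absurd h hq⟩, fun _ => rfl⟩

/-- Expansion of the form on a combination of the generators (no radical part). [folklore] -/
theorem apply_combination₀ (b₁ b₂ b₃ : ℤ) (t : S) :
    C (b₁ • s₁ + b₂ • s₂ + b₃ • s₃) t = b₁ • C s₁ t + b₂ • C s₂ t + b₃ • C s₃ t := by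
  rw [map_add, map_add, map_zsmul, map_zsmul, map_zsmul, AddMonoidHom.add_apply, AddMonoidHom.add_apply,
    AddMonoidHom.zsmul_apply, AddMonoidHom.zsmul_apply, AddMonoidHom.zsmul_apply]

/-- **THE KERNEL OF A NON-ZERO ALTERNATING FORM ON THREE GENERATORS IS THE ADJUGATE LINE** (coefficient form): if
`w = b₁s₁ + b₂s₂ + b₃s₃` pairs to zero with `s₁, s₂, s₃` and not all three entries vanish, then either all `bᵢ` are even, or
`bᵢ` is odd exactly when the complementary entry `c_jk` is non-zero (`{i,j,k} = {1,2,3}`) — i.e. `w ≡ 0` or `w ≡ v` modulo `2`.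
Over `𝔽₂`: the null space of a non-zero skew `3 × 3` matrix is spanned by its Pfaffian vector `(c₂₃, c₁₃, c₁₂)`. [folklore] -/
theorem coeff_pattern_of_apply_gen_eq_zero (h2 : ∀ s : S, (2 : ℕ) • s = 0) (halt : ∀ s, C s s = 0)
    (hT : ∀ x y : T, (2 : ℕ) • x = 0 → (2 : ℕ) • y = 0 → x = 0 ∨ y = 0 ∨ x = y)
    (hne : ¬ (C s₁ s₂ = 0 ∧ C s₁ s₃ = 0 ∧ C s₂ s₃ = 0)) (b₁ b₂ b₃ : ℤ)
    (hw₁ : C (b₁ • s₁ + b₂ • s₂ + b₃ • s₃) s₁ = 0) (hw₂ : C (b₁ • s₁ + b₂ • s₂ + b₃ • s₃) s₂ = 0)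
    (hw₃ : C (b₁ • s₁ + b₂ • s₂ + b₃ • s₃) s₃ = 0) :
    (2 ∣ b₁ ∧ 2 ∣ b₂ ∧ 2 ∣ b₃) ∨
      ((2 ∣ b₁ ↔ C s₂ s₃ = 0) ∧ (2 ∣ b₂ ↔ C s₁ s₃ = 0) ∧ (2 ∣ b₃ ↔ C s₁ s₂ = 0)) := by
  -- a non-zero entry `τ`; every entry is `0` or `τ`
  have h2c : ∀ s t, (2 : ℕ) • C s t = 0 := two_nsmul_apply_eq_zero C h2
  obtain ⟨τ, hτ, h2τ⟩ : ∃ τ : T, τ ≠ 0 ∧ (2 : ℕ) • τ = 0 := by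
    by_cases h₁₂ : C s₁ s₂ = 0
    · by_cases h₁₃ : C s₁ s₃ = 0
      · exact ⟨C s₂ s₃, fun h => hne ⟨h₁₂, h₁₃, h⟩, h2c _ _⟩
      · exact ⟨C s₁ s₃, h₁₃, h2c _ _⟩
    · exact ⟨C s₁ s₂, h₁₂, h2c _ _⟩
  have hval : ∀ s t, C s t = 0 ∨ C s t = τ := fun s t => by
    rcases hT (C s t) τ (h2c s t) h2τ with h | h | h
    · exact Or.inl h
    · exact absurd h hτ
    · exact Or.inr h
  -- expand the three equations in the entries
  have h₂₁ : C s₂ s₁ = C s₁ s₂ := apply_comm C h2 halt s₂ s₁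
  have h₃₁ : C s₃ s₁ = C s₁ s₃ := apply_comm C h2 halt s₃ s₁
  have h₃₂ : C s₃ s₂ = C s₂ s₃ := apply_comm C h2 halt s₃ s₂
  rw [apply_combination₀ C s₁ s₂ s₃, halt, smul_zero, zero_add, h₂₁, h₃₁] at hw₁
  rw [apply_combination₀ C s₁ s₂ s₃, halt, smul_zero, add_zero, h₃₂] at hw₂
  rw [apply_combination₀ C s₁ s₂ s₃, halt, smul_zero, add_zero] at hw₃
  -- `hw₁ : b₂ • c₁₂ + b₃ • c₁₃ = 0`, `hw₂ : b₁ • c₁₂ + b₃ • c₂₃ = 0`, `hw₃ : b₁ • c₁₃ + b₂ • c₂₃ = 0`; entries are `0` or `τ`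
  rcases hval s₁ s₂ with h₁₂ | h₁₂ <;> rcases hval s₁ s₃ with h₁₃ | h₁₃ <;> rcases hval s₂ s₃ with h₂₃ | h₂₃
  · exact absurd ⟨h₁₂, h₁₃, h₂₃⟩ hne
  all_goals
    simp only [h₁₂, h₁₃, h₂₃, smul_zero, zero_add, add_zero, hτ, iff_false, iff_true,
      zsmul_eq_ite_of_two_nsmul _ h2τ, ite_add_ite_eq_zero_iff hτ h2τ, ite_eq_left_iff] at hw₁ hw₂ hw₃ ⊢
    tauto

/-- **A RADICAL COMBINATION IS `0` OR THE ADJUGATE VECTOR** (element form): under the same hypotheses,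
`b₁s₁ + b₂s₂ + b₃s₃ = 0` or `= v = [c₂₃ ≠ 0]s₁ + [c₁₃ ≠ 0]s₂ + [c₁₂ ≠ 0]s₃`. [folklore] -/
theorem combination_eq_zero_or_eq_adjugate (h2 : ∀ s : S, (2 : ℕ) • s = 0) (halt : ∀ s, C s s = 0)
    (hT : ∀ x y : T, (2 : ℕ) • x = 0 → (2 : ℕ) • y = 0 → x = 0 ∨ y = 0 ∨ x = y) (v : S)
    (hv : v = (if C s₂ s₃ = 0 then 0 else s₁) + (if C s₁ s₃ = 0 then 0 else s₂) + (if C s₁ s₂ = 0 then 0 else s₃))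
    (hne : ¬ (C s₁ s₂ = 0 ∧ C s₁ s₃ = 0 ∧ C s₂ s₃ = 0)) (b₁ b₂ b₃ : ℤ)
    (hw : ∀ u, C (b₁ • s₁ + b₂ • s₂ + b₃ • s₃) u = 0) :
    b₁ • s₁ + b₂ • s₂ + b₃ • s₃ = 0 ∨ b₁ • s₁ + b₂ • s₂ + b₃ • s₃ = v := by
  rcases coeff_pattern_of_apply_gen_eq_zero C s₁ s₂ s₃ h2 halt hT hne b₁ b₂ b₃ (hw s₁) (hw s₂) (hw s₃) with
    ⟨hb₁, hb₂, hb₃⟩ | ⟨hb₁, hb₂, hb₃⟩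
  · left
    rw [zsmul_eq_ite_of_two_nsmul b₁ (h2 s₁), zsmul_eq_ite_of_two_nsmul b₂ (h2 s₂),
      zsmul_eq_ite_of_two_nsmul b₃ (h2 s₃), if_pos hb₁, if_pos hb₂, if_pos hb₃, add_zero, add_zero]
  · right
    rw [hv, zsmul_eq_ite_of_two_nsmul b₁ (h2 s₁), zsmul_eq_ite_of_two_nsmul b₂ (h2 s₂),
      zsmul_eq_ite_of_two_nsmul b₃ (h2 s₃)]
    simp only [hb₁, hb₂, hb₃]

end Kernel

/-! ## §3 Counting: a group generated by a finite image and two elements killed by `2` -/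

section Counting

variable {S : Type*} [AddCommGroup S]

/-- **`#S ≤ 4·#A`** when `S` is generated by the image of a finite group `A` and two elements killed by `2`. (Surjection
`A × Bool × Bool ↠ S`.) Used to show that the adjugate vector is not a torsion class: on the jump-one class `#Sel₂(E_n) = 32` while
`4 · #E_n(ℚ)[2] = 16`. [folklore] -/
theorem natCard_le_of_generated_two {A : Type*} [Finite A] (κ : A → S) (s₁ s₂ : S) (hs₁ : (2 : ℕ) • s₁ = 0)
    (hs₂ : (2 : ℕ) • s₂ = 0) (hgen : ∀ t : S, ∃ a : A, ∃ b₁ b₂ : ℤ, t = κ a + b₁ • s₁ + b₂ • s₂) :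
    Nat.card S ≤ Nat.card A * 4 := by
  let f : A × Bool × Bool → S := fun x => κ x.1 + (if x.2.1 then s₁ else 0) + (if x.2.2 then s₂ else 0)
  have hf : Function.Surjective f := by
    intro t
    obtain ⟨a, b₁, b₂, rfl⟩ := hgen t
    refine ⟨(a, decide (¬ 2 ∣ b₁), decide (¬ 2 ∣ b₂)), ?_⟩
    simp only [f, decide_eq_true_eq, ite_not, zsmul_eq_ite_of_two_nsmul b₁ hs₁, zsmul_eq_ite_of_two_nsmul b₂ hs₂]
  calc Nat.card S ≤ Nat.card (A × Bool × Bool) := Nat.card_le_card_of_surjective f hf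
    _ = Nat.card A * 4 := by rw [Nat.card_prod, Nat.card_prod, Nat.card_eq_fintype_card (α := Bool), Fintype.card_bool]


/-- **Redundant third generator**: if `S` is generated by `κ(A)` and `s₁ s₂ s₃` (`κ : A →+ S` additive, `A` finite) and `s₃` is itself
a combination `κ a₀ + e₁s₁ + e₂s₂`, then `#S ≤ 4·#A`. [folklore] -/
theorem natCard_le_of_redundant {A : Type*} [AddCommGroup A] [Finite A] (κ : A →+ S) (s₁ s₂ s₃ : S)
    (hs₁ : (2 : ℕ) • s₁ = 0) (hs₂ : (2 : ℕ) • s₂ = 0)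
    (hgen : ∀ t : S, ∃ a : A, ∃ b₁ b₂ b₃ : ℤ, t = κ a + b₁ • s₁ + b₂ • s₂ + b₃ • s₃)
    (a₀ : A) (e₁ e₂ : ℤ) (h₃ : s₃ = κ a₀ + e₁ • s₁ + e₂ • s₂) : Nat.card S ≤ Nat.card A * 4 := by
  refine natCard_le_of_generated_two κ s₁ s₂ hs₁ hs₂ fun t => ?_
  obtain ⟨a, b₁, b₂, b₃, rfl⟩ := hgen t
  refine ⟨a + b₃ • a₀, b₁ + b₃ * e₁, b₂ + b₃ * e₂, ?_⟩
  rw [h₃, map_add, map_zsmul, smul_add, smul_add, smul_smul, smul_smul, add_smul, add_smul]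
  abel

end Counting

end Summit.BirchSwinnertonDyer.PrintCf2.AdjugateForm

end
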